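import Mathlib.Tactic.Linarith
import Mathlib.Tactic.NormNum
import Mathlib.Tactic.Ring
import HarnessLib

/-!
# The (0,1) cell of the ι-window, XXVII-C: the product ground `B₁ × B₂`, XIV (ADDENDUM 2) — the NODE AXIS: the canonical gluing, the gluing
# Euler characteristic, the local index at the sixteen fixed points, EXAMPLE N / N′ (report [XXVII] §15): arithmetic shadows

Family `hodge`, b2b cell `hweil` (helper of item stmt-HodgeConjecture-2524). Second companion (`pg14b_*`) of
`WeilTypeLadderH2ProductGroundFourteen.lean` (same seat). Report `run/shared/lean/b2b/hodge-weil/b2b-hweil-pv1-g39/H2-ZERO-ONE-27.md` ([XXVII]) §15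
(ADDENDUM 2); script `code/pv1-g39/example_n.py`. HONEST FRAMING: census results inside the ladder's H2 test ((0,1) cell) on the SPECIAL fourfold
`X₀ = B₁ × B₂`; nothing here is a rung; no case of the Hodge conjecture is proved; no statement of [Markman 2025] / [Perry 2026] / [EdGFS 2025] is
used. Every theorem is a def-free arithmetic identity that the report cites at the step named in its docstring; none claims geometry.
-/

-- mandated namespace `Summit.HodgeConjecture.HodgeConjecture.…` (Problem = Summit) trips `linter.dupNamespace`; the lakefile disables it
-- tree-wide (weak option), restated here so stand-alone elaboration is warning-free too.
set_option linter.dupNamespace false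

namespace Summit.HodgeConjecture.HodgeConjecture.WeilTypeLadder

section ProductGroundFourteenAdd2

/-- **LEMMA GLUE-N ([XXVII] 15.1 (c)), the gluing Euler characteristic.** On `V_w ≅ B₂` a symmetric line bundle of class `kθ₂` has `χ = k²`; the
conductor cover has `δ̄_*𝒪_{C̃} = 𝒪 ⊕ L₀⁻¹` with `L₀ ≡ 2θ₂`; so for the gluing line bundle `𝒩 ≡ n₀θ₂`:
`χ(𝒢) = χ(𝒩 ⊕ 𝒩L₀⁻¹) − ℓ_𝓜 − (χ(𝒩) − ℓ(W₀)) + χ_T = (n₀ − 2)² + ℓ(W₀) − ℓ_𝓜 + χ_T` — the identity `n₀² + (n₀ − 2)² − n₀² = (n₀ − 2)²` —, and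
`c₁(𝒢) = (n₀ − 2)θ₂ + τ′`. The values `(n₀ − 2)²` on the CS2-N windows `n₀ ∈ {−2,…,2}` are `16, 9, 4, 1, 0`. [`ring` / `norm_num`] -/
theorem pg14b_gluing_euler (n₀ lM lW χT : ℤ) :
    (n₀ ^ 2 + (n₀ - 2) ^ 2 - lM) - (n₀ ^ 2 - lW) + χT = (n₀ - 2) ^ 2 + lW - lM + χT ∧
    (((-2:ℤ) - 2) ^ 2 = 16 ∧ ((-1:ℤ) - 2) ^ 2 = 9 ∧ ((0:ℤ) - 2) ^ 2 = 4 ∧ ((1:ℤ) - 2) ^ 2 = 1 ∧ ((2:ℤ) - 2) ^ 2 = 0) := by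
  refine ⟨by ring, by norm_num⟩

/-- **LEMMA FIX-N ([XXVII] 15.2), the local index at a fixed point `(w, w₂)` of a node-axis support.** The index is multiplicative on
Tor-independent derived tensor products; `𝒪_Σ` cut by an EVEN local equation has supertrace `1 − 1 = 0`, the ideal `(b₁, b₂)` of the curve
`E_{t₀} × {w₂}` through the fixed point has supertrace `(−1 − 1) − (+1) = −3` (two odd generators, one even Koszul relation); so
`t_x(𝓘·𝒪_Σ) = (−3)·0 = 0` and `t_x(𝒪_Σ) = 0`: EXAMPLE N is BALANCED at all sixteen fixed points `(w, w₂′)` (`15 + 1 = 16`). [`norm_num`] -/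
theorem pg14b_fixed_point_index :
    ((1:ℤ) - 1 = 0) ∧ (((-1:ℤ) + (-1)) - 1 = -3) ∧ ((-3:ℤ) * (1 - 1) = 0) ∧ (15 + 1 = (16:ℕ)) := by
  norm_num

/-- **EXAMPLE N and N′ ([XXVII] 15.3), `ch = W` entry by entry.** N (hull `W₀`, pattern `(1; 0,1,0 | 2; 0,0,0,−1)`): Künneth pt₁-row `(3, 2, 2)`
(`node_axis.py`), cosupport `Γ₁ = {w₁} × D` (class `(2,0)`, degree `4·2 − 2 = 6` on genus 5: `χ = 2`) and `Γ₂ = E_{t₂(w₂)} × {w₂}` (class `(0,2)`,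
degree `4 + 2 = 6` on the genus-4 normalisation: `χ = 6 + 1 − 4 = 3`), gluing row `(r, γ′, χ(𝒢)) = (1, 2 − 2, (2−2)² + 1 − 2) = (1, 0, −1)`:
`(pt₁,1)`: `3 − 1 = 2`; `(pt₁,θ₂)`: `2 − 2 − 0 = 0`; `(θ₁,pt₂)`: `2 − 2 = 0`; `(pt₁,pt₂)`: `2 − (2 + 3) − (−1) = −2` — `= W`. N′ (hull `W₀′`,
`(2; 0,0,−1 | 1; 0,0,0,1)`, `𝒩 ≡ θ₂`): pt₁-row `(3, 1, 1)`, `P_q`-lengths `2·λ(−2) = 2`, cosupport `χ = 2 + 3`, gluing row `(1, 1 − 2, (1−2)² + 1 − 2) =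
(1, −1, 0)`: `3 − 1 = 2`, `1 − 2 − (−1) = 0`, `1 + 2 − 5 − 0 = −2` — `= W`. [`norm_num`] -/
theorem pg14b_example_N :
    ((3:ℤ) - 1 = 2) ∧ ((2:ℤ) - 2 - 0 = 0) ∧ ((2:ℤ) - 2 = 0) ∧ ((4:ℤ) * 2 - 2 = 6) ∧ ((6:ℤ) + 1 - 5 = 2) ∧ ((4:ℤ) + 2 = 6) ∧ ((6:ℤ) + 1 - 4 = 3) ∧
    (((2:ℤ) - 2) ^ 2 + 1 - 2 = -1) ∧ ((2:ℤ) - (2 + 3) - (-1) = -2) ∧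
    (((1:ℤ) - 2) ^ 2 + 1 - 2 = 0) ∧ ((1:ℤ) - 2 - (-1) = 0) ∧ ((1:ℤ) + 2 - 5 - 0 = -2) := by
  norm_num

/-- **[XXVII] 15.1 (d) (the refined windows).** PIN-N (a) says `v_wη + Δ̃` is a pull-back class while `kη` is a pull-back only for `k` even (`2L = 1`
has no integer solution): for `v_w = ±1` (hulls `W_w`, `W_w′`) the window `m = 0` (`Δ̃ = 0`) is struck — three windows remain on each —, and for
`v_w = 0` (`W₀`, `W₀′`) the class of `Δ̃` is a pull-back. EXAMPLE N sits at `W₀`'s window `(n₀, m) = (2, 0)`, EXAMPLE N′ at `W₀′`'s `(1, 0)`; both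
transport over the node-axis stratum of dimension `2 + 4 + 3 = 9 ≥ 2`. [`omega` / `norm_num`] -/
theorem pg14b_refined_windows :
    (∀ L : ℤ, 2 * L ≠ 1 ∧ 2 * L ≠ -1) ∧ (4 - 1 = (3:ℕ)) ∧ (2 + 4 + 3 = (9:ℕ)) ∧ (2 ≤ (9:ℕ)) := by
  refine ⟨fun L => by omega, by norm_num, by norm_num, by norm_num⟩

end ProductGroundFourteenAdd2

end Summit.HodgeConjecture.HodgeConjecture.WeilTypeLadder
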